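import Summits.AnomalousDissipation.AnomalousDissipation.Theorems.StirringSphereEnsembleRealizationStubAugCurrentLevelDriftBase

/-!
# Crux `EnsembleRealization` (stmt-AnomalousDissipation-0215) — line `augmented-lift`,
# sub-stub (M1a) `stub_augCurrentLevelPairs`, piece (L5)/Drift: the drift link

Supports stmt-AnomalousDissipation-0215 (stub `stub_augCurrentLevelPairs` of line
`augmented-lift`, piece L5 `stub_augCurrentLevelLinkTools`, DRIFT part of step (A6) of
`augCurrent-notes.md` §3). Nothing here closes an item. Theorems only.

DRIFT LINK. Along a sequence of levels (bases `g n` complete for `P_{N n}` on `H` and on `𝒱`,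
product mollifiers `ρ₁ n ⊗ ρ₂ n` of width `δ n → 0`, mollified coordinate laws
`p₁ n (z) = ∫ ρ(z − Z u) dμ`, currents `(J n z)ⱼ = ∫ ρ(z − Z u) ⟨F(u), gⱼ⟩ dμ`, mixing weights
`ε n → 0`, `θ n = R/(R + δ n)`, velocity `V = ((1 − ε)/q) J`, `q = (1 − ε) p₁ + ε c`, level laws
`m n` given by the transport formula `∫ G d(m n) = (1 − ε) ∫ G p₁ + ε c ∫_{Bx} G`), the level drift
`∫ ⟪a, θ Σⱼ (V z)ⱼ gⱼ⟫` is `L¹(m n)`-close to any bounded continuous observable `c` of the level modes,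
up to `∫ |⟨F(u), a⟩ − c(û)| dμ + γ`, eventually. Proof: the drift is `s(z) ∫ ρ(z − Z u) X_n(u) dμ`
with `s = (1 − ε)/q`, `X_n(u) = θ_n ⟨F(u), P_{N n} a⟩` (`drift_integrand_eq`); pointwise
`|drift − c| p₁ ≤ |∫ ρ(z − Z u) X_n dμ − p₁ c| + (ε c_n p₁/q) |c|`, the second term has
`vol`-integral `≤ ε B/(1 − ε)` (it lives on the box, `c_n vol(Bx) = 1`); the first is handled by
the Jensen–Fubini inequality `integral_abs_kernel_sub_le`, dominated convergence in `u` (weights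
`|X_n| ≤ K(1 + R²)`, `exists_abs_nsGeneratorPairing_fourierTruncate_le`) and the pointwise limit
`stub_augCurrentLevelDriftBaseTools` fed by `ae_tendsto_theta_mul_nsGeneratorPairing` (`θ_n → 1` if `R > 0`; the
Liouville equation at rest if `R = 0`); the uniform part of `m n` contributes `≤ ε (M + B)`.
-/

noncomputable section

set_option linter.dupNamespace false

open MeasureTheory Set Filter Topology Function Metric UnitAddTorus
open scoped BigOperators ENNReal InnerProductSpace RealInnerProductSpace

namespace Summit.AnomalousDissipation.AnomalousDissipation.Theorems.EnsembleRealization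

open Literature.Analysis.FunctionSpaces Literature.Analysis.FunctionSpaces.Torus
open Literature.Analysis.FluidPDE Literature.Analysis.FluidPDE.Torus

/-- **The drift integrand of a level pair** (head start for DRIFT): if `V z = r • J z` and
`J_w,j(z) = ∫ κ(u) ⟨F(u), gⱼ⟩ dμ`, then for a test field `a` with `Σⱼ (a, gⱼ) gⱼ = P_N a`,
`∫ ⟪a, θ Σⱼ (V z)ⱼ gⱼ⟫ = θ r ∫ κ(u) ⟨F(u), P_N a⟩ dμ`. -/
theorem drift_integrand_eq {ν : ℝ} {f : UnitAddTorus (Fin 3) → EuclideanSpace ℝ (Fin 3)}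
    {μ : Measure (Torus.energySpace (Fin 3))} (hf : IsSmooth f)
    {D : ℕ} {g : Fin D → UnitAddTorus (Fin 3) → EuclideanSpace ℝ (Fin 3)} (hg : ∀ j, IsSmooth (g j)) {N : ℕ}
    {a : UnitAddTorus (Fin 3) → EuclideanSpace ℝ (Fin 3)} (ha : IsSmooth a)
    (hgA : ∀ x, ∑ j, (∫ y, ⟪a y, g j y⟫_ℝ) • g j x = fourierTruncate N a x)
    (θ r : ℝ) (κ : Torus.energySpace (Fin 3) → ℝ)
    (hκ : ∀ j, Integrable (fun u => κ u * nsGeneratorPairing ν f u (g j)) μ)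
    (Vz Jz : EuclideanSpace ℝ (Fin D) × ℝ) (hV : Vz = r • Jz)
    (hJw : ∀ j, Jz.1 j = ∫ u, κ u * nsGeneratorPairing ν f u (g j) ∂μ) :
    ∫ x, ⟪a x, θ • ∑ j, Vz.1 j • g j x⟫_ℝ = θ * r * ∫ u, κ u * nsGeneratorPairing ν f u (fourierTruncate N a) ∂μ := by
  rw [integral_inner_synth hg ha.integrable θ Vz.1, mul_assoc]
  congr 1
  have hVj : ∀ j, Vz.1 j = r * Jz.1 j := fun j => by rw [hV]; rfl
  have h1 : ∀ u, nsGeneratorPairing ν f u (fourierTruncate N a) =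
      ∑ j, (∫ y, ⟪a y, g j y⟫_ℝ) * nsGeneratorPairing ν f u (g j) := fun u => by
    rw [← show (fun x => ∑ j, (∫ y, ⟪a y, g j y⟫_ℝ) • g j x) = fourierTruncate N a from funext hgA]
    exact nsGeneratorPairing_sum_smul ν hf.integrable u Finset.univ _ fun j _ => hg j
  simp_rw [h1, Finset.mul_sum]
  rw [integral_finsetSum _ fun j _ => ((hκ j).const_mul _).congr (Eventually.of_forall fun u => by ring),
    Finset.mul_sum]
  refine Finset.sum_congr rfl fun j _ => ?_
  rw [hVj, hJw, mul_assoc, ← integral_mul_const]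
  congr 1
  exact integral_congr_ae (Eventually.of_forall fun u => by simp only; ring)

/-- **(L5b) DRIFT link** of the level pairs of (M1a). See the module docstring. -/
theorem stub_augCurrentLevelDriftTools {ν : ℝ} {f : UnitAddTorus (Fin 3) → EuclideanSpace ℝ (Fin 3)}
    {μ : Measure (Torus.energySpace (Fin 3))} (hf : IsSmooth f) (hμ : IsStationaryStatisticalSolution ν f μ)
    {R : ℝ} (hR : ∀ᵐ u ∂μ, ‖u‖ ≤ R) (hR0 : 0 ≤ R)
    (D : ℕ → ℕ) (g : (n : ℕ) → Fin (D n) → UnitAddTorus (Fin 3) → EuclideanSpace ℝ (Fin 3))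
    (N : ℕ → ℕ) (δ ε c θ : ℕ → ℝ)
    (ρ₁ : (n : ℕ) → EuclideanSpace ℝ (Fin (D n)) → ℝ) (ρ₂ : ℕ → ℝ → ℝ)
    (p₁ : (n : ℕ) → EuclideanSpace ℝ (Fin (D n)) × ℝ → ℝ)
    (J V : (n : ℕ) → EuclideanSpace ℝ (Fin (D n)) × ℝ → EuclideanSpace ℝ (Fin (D n)) × ℝ)
    (m : (n : ℕ) → Measure (EuclideanSpace ℝ (Fin (D n)) × ℝ))
    (hN : Tendsto N atTop atTop) (hδ : ∀ n, 0 < δ n ∧ δ n ≤ 1) (hδ0 : Tendsto δ atTop (𝓝 0))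
    (hε : ∀ n, 0 < ε n ∧ ε n < 1) (hε0 : Tendsto ε atTop (𝓝 0))
    (hθ : ∀ n, θ n = R / (R + δ n))
    (hg : ∀ n j, IsSmooth (g n j))
    (horth : ∀ n i j, ∫ x, ⟪g n i x, g n j x⟫_ℝ = if i = j then 1 else 0)
    (hgH : ∀ n (u : Torus.energySpace (Fin 3)) x, ∑ j, pairing u.1 (g n j) • g n j x =
      fourierTruncate (N n) (u.1 : UnitAddTorus (Fin 3) → EuclideanSpace ℝ (Fin 3)) x)
    (hgA : ∀ n (a : UnitAddTorus (Fin 3) → EuclideanSpace ℝ (Fin 3)), IsSmooth a → IsDivFree a → HasZeroMean a →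
      ∀ x, ∑ j, (∫ y, ⟪a y, g n j y⟫_ℝ) • g n j x = fourierTruncate (N n) a x)
    (hρ₁ : ∀ n, Continuous (ρ₁ n) ∧ (∀ y, 0 ≤ ρ₁ n y) ∧ (∀ y, δ n ≤ ‖y‖ → ρ₁ n y = 0) ∧ ∫ y, ρ₁ n y = 1)
    (hρ₂ : ∀ n, Continuous (ρ₂ n) ∧ (∀ s, 0 ≤ ρ₂ n s) ∧ (∀ s, s ∉ Ioo 0 (δ n) → ρ₂ n s = 0) ∧ ∫ s, ρ₂ n s = 1)
    (hp : ∀ n, Continuous (p₁ n)) (hp0 : ∀ n z, 0 ≤ p₁ n z)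
    (hpB : ∀ n z, z ∉ closedBall (0 : EuclideanSpace ℝ (Fin (D n))) (R + δ n) ×ˢ Icc 0 (R ^ 2 + δ n) → p₁ n z = 0)
    (hp1 : ∀ n, ∫ z, p₁ n z ∂((volume : Measure (EuclideanSpace ℝ (Fin (D n)))).prod (volume : Measure ℝ)) = 1)
    (hpZ : ∀ n (z : EuclideanSpace ℝ (Fin (D n)) × ℝ),
      p₁ n z = ∫ u, ρ₁ n (z.1 - WithLp.toLp 2 fun j => pairing u.1 (g n j)) * ρ₂ n (z.2 - ‖u‖ ^ 2) ∂μ)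
    (hJc : ∀ n, Continuous (J n))
    (hJw : ∀ n z j, (J n z).1 j = ∫ u, ρ₁ n (z.1 - WithLp.toLp 2 fun j => pairing u.1 (g n j)) * ρ₂ n (z.2 - ‖u‖ ^ 2) *
      nsGeneratorPairing ν f u (g n j) ∂μ)
    (hq : ∀ n z, 0 < (1 - ε n) * p₁ n z + ε n * c n)
    (hV : ∀ n z, V n z = ((1 - ε n) / ((1 - ε n) * p₁ n z + ε n * c n)) • J n z)
    (hm : ∀ n, IsProbabilityMeasure (m n))
    (htr : ∀ n (G : EuclideanSpace ℝ (Fin (D n)) × ℝ → ℝ), Continuous G →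
      ∫ z, G z ∂(m n) = (1 - ε n) * ∫ z, G z * p₁ n z ∂((volume : Measure (EuclideanSpace ℝ (Fin (D n)))).prod (volume : Measure ℝ)) +
        ε n * c n * ∫ z in closedBall (0 : EuclideanSpace ℝ (Fin (D n))) (R + δ n) ×ˢ Icc 0 (R ^ 2 + δ n), G z
          ∂((volume : Measure (EuclideanSpace ℝ (Fin (D n)))).prod (volume : Measure ℝ))) :
    (∀ a : UnitAddTorus (Fin 3) → EuclideanSpace ℝ (Fin 3), IsSmooth a → IsDivFree a → HasZeroMean a →
        ∀ c : ((Fin 3 → ℤ) → EuclideanSpace ℂ (Fin 3)) → ℝ, Continuous c → (∃ B : ℝ, ∀ z, |c z| ≤ B) →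
        ∀ γ : ℝ, 0 < γ → ∀ᶠ n in atTop,
          ∫ z, |(∫ x, ⟪a x, θ n • ∑ j, (V n z).1 j • g n j x⟫_ℝ) -
              c (fun k : Fin 3 → ℤ => mFourierCoeff (EuclideanSpace.complexify ∘ fun x => θ n • ∑ j, z.1 j • g n j x) k)| ∂(m n) ≤
            (∫ u, |nsGeneratorPairing ν f u a - c (fun k : Fin 3 → ℤ => mFourierCoeff (EuclideanSpace.complexify ∘ (u.1 : UnitAddTorus (Fin 3) → EuclideanSpace ℝ (Fin 3))) k)| ∂μ) + γ) := by
  intro a ha hadiv hamean cc hcc hcB γ hγ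
  obtain ⟨B, hB⟩ := hcB
  haveI := hμ.prob
  have hB0 : 0 ≤ B := (abs_nonneg _).trans (hB fun _ => 0)
  -- the truncated tests are admissible uniformly; a.e. limit of the drift weights
  obtain ⟨K, hK0, hK⟩ := exists_abs_nsGeneratorPairing_fourierTruncate_le ν hf ha
  have hXlim := ae_tendsto_theta_mul_nsGeneratorPairing hf hμ hR hR0 N δ θ hN hδ0 hθ ha hadiv hamean
  have hθ01 : ∀ n, 0 ≤ θ n ∧ θ n ≤ 1 := fun n => by
    have hRδ : 0 < R + δ n := by linarith [(hδ n).1]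
    exact ⟨by rw [hθ n]; exact div_nonneg hR0 hRδ.le, by rw [hθ n, div_le_one hRδ]; linarith [(hδ n).1]⟩
  have hc0 : ∀ n, 0 < c n := fun n => by
    have h1 : p₁ n ((0 : EuclideanSpace ℝ (Fin (D n))), (-1 : ℝ)) = 0 := hpB n _ fun h => by
      have h2 := (Set.mem_prod.1 h).2.1
      norm_num at h2
    have h := hq n ((0 : EuclideanSpace ℝ (Fin (D n))), (-1 : ℝ))
    rw [h1, mul_zero, zero_add] at h
    exact (mul_pos_iff_of_pos_left (hε n).1).1 h
  set M : ℝ := K * (1 + R ^ 2) with hM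
  -- level objects
  let vol : (n : ℕ) → Measure (EuclideanSpace ℝ (Fin (D n)) × ℝ) := fun n =>
    (volume : Measure (EuclideanSpace ℝ (Fin (D n)))).prod (volume : Measure ℝ)
  let Bx : (n : ℕ) → Set (EuclideanSpace ℝ (Fin (D n)) × ℝ) := fun n =>
    closedBall (0 : EuclideanSpace ℝ (Fin (D n))) (R + δ n) ×ˢ Icc 0 (R ^ 2 + δ n)
  let Z : (n : ℕ) → Torus.energySpace (Fin 3) → EuclideanSpace ℝ (Fin (D n)) × ℝ :=
    fun n u => (WithLp.toLp 2 fun j => pairing u.1 (g n j), ‖u‖ ^ 2)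
  let ρ : (n : ℕ) → EuclideanSpace ℝ (Fin (D n)) × ℝ → ℝ := fun n y => ρ₁ n y.1 * ρ₂ n y.2
  let Ψ : (n : ℕ) → EuclideanSpace ℝ (Fin (D n)) → ((Fin 3 → ℤ) → EuclideanSpace ℂ (Fin 3)) :=
    fun n w k => mFourierCoeff (EuclideanSpace.complexify ∘ fun x => θ n • ∑ j, w j • g n j x) k
  let C : (n : ℕ) → EuclideanSpace ℝ (Fin (D n)) × ℝ → ℝ := fun n z => cc (Ψ n z.1)
  let X : ℕ → Torus.energySpace (Fin 3) → ℝ := fun n u => θ n * nsGeneratorPairing ν f u (fourierTruncate (N n) a)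
  let s : (n : ℕ) → EuclideanSpace ℝ (Fin (D n)) × ℝ → ℝ := fun n z => (1 - ε n) / ((1 - ε n) * p₁ n z + ε n * c n)
  let η : (n : ℕ) → EuclideanSpace ℝ (Fin (D n)) × ℝ → ℝ := fun n z =>
    ε n * c n * p₁ n z / ((1 - ε n) * p₁ n z + ε n * c n) * |C n z|
  let drift : (n : ℕ) → EuclideanSpace ℝ (Fin (D n)) × ℝ → ℝ := fun n z =>
    ∫ x, ⟪a x, θ n • ∑ j, (V n z).1 j • g n j x⟫_ℝ
  let G : (n : ℕ) → EuclideanSpace ℝ (Fin (D n)) × ℝ → ℝ := fun n z => |drift n z - C n z|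
  let Φ : ℕ → Torus.energySpace (Fin 3) → ℝ := fun n u => ∫ y, ρ n y * |X n u - C n (Z n u + y)| ∂(vol n)
  let I : ℝ := ∫ u, |nsGeneratorPairing ν f u a - cc (fun k : Fin 3 → ℤ =>
    mFourierCoeff (EuclideanSpace.complexify ∘ (u.1 : UnitAddTorus (Fin 3) → EuclideanSpace ℝ (Fin 3))) k)| ∂μ
  show ∀ᶠ n in atTop, ∫ z, G n z ∂(m n) ≤ I + γ
  -- kernels
  have hρc : ∀ n, Continuous (ρ n) := fun n =>
    ((hρ₁ n).1.comp continuous_fst).mul ((hρ₂ n).1.comp continuous_snd)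
  have hρ0 : ∀ n y, 0 ≤ ρ n y := fun n y => mul_nonneg ((hρ₁ n).2.1 _) ((hρ₂ n).2.1 _)
  have hρδ : ∀ n y, ρ n y ≠ 0 → ‖y.1‖ < δ n ∧ |y.2| < δ n := fun n y hy => by
    refine ⟨not_le.1 fun h' => hy ?_, ?_⟩
    · show ρ₁ n y.1 * ρ₂ n y.2 = 0
      rw [(hρ₁ n).2.2.1 _ h', zero_mul]
    · have hy2 : y.2 ∈ Ioo 0 (δ n) := by
        by_contra h'
        exact hy (show ρ₁ n y.1 * ρ₂ n y.2 = 0 by rw [(hρ₂ n).2.2.1 _ h', mul_zero])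
      rw [abs_of_pos hy2.1]
      exact hy2.2
  have hρcs : ∀ n, HasCompactSupport (ρ n) := fun n => by
    refine HasCompactSupport.intro (K := closedBall (0 : EuclideanSpace ℝ (Fin (D n))) (δ n) ×ˢ Icc (-δ n) (δ n))
      ((isCompact_closedBall _ _).prod isCompact_Icc) fun y hy => ?_
    by_contra h
    obtain ⟨h1, h2⟩ := hρδ n y h
    exact hy (Set.mem_prod.2 ⟨mem_closedBall_zero_iff.2 h1.le, abs_le.1 h2.le⟩)
  have hρi : ∀ n, Integrable (ρ n) (vol n) := fun n => (hρc n).integrable_of_hasCompactSupport (hρcs n)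
  have hρ1 : ∀ n, ∫ y, ρ n y ∂(vol n) = 1 := fun n => by
    show ∫ y, ρ₁ n y.1 * ρ₂ n y.2 ∂((volume : Measure (EuclideanSpace ℝ (Fin (D n)))).prod (volume : Measure ℝ)) = 1
    rw [integral_prod_mul, (hρ₁ n).2.2.2, (hρ₂ n).2.2.2, one_mul]
  have hρK : ∀ n, ∃ Kρ : ℝ, ∀ y, ρ n y ≤ Kρ := fun n => by
    obtain ⟨Kρ, hKρ⟩ := (hρc n).bounded_above_of_compact_support (hρcs n)
    exact ⟨Kρ, fun y => (le_abs_self _).trans ((Real.norm_eq_abs _).symm.trans_le (hKρ y))⟩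
  choose Kρ hKρ using hρK
  have hKρ0 : ∀ n, 0 ≤ Kρ n := fun n => (hρ0 n 0).trans (hKρ n 0)
  have hZc : ∀ n, Continuous (Z n) := fun n =>
    ((PiLp.continuous_toLp 2 _).comp (continuous_pi fun j => continuous_pairing_coe ((hg n j).memLp 2))).prodMk
      (continuous_norm.pow 2)
  have hBxfin : ∀ n, vol n (Bx n) < ∞ := fun n => ((isCompact_closedBall _ _).prod isCompact_Icc).measure_lt_top
  -- observables and weights
  have hΨc : ∀ n, Continuous (Ψ n) := fun n => continuous_pi fun k => continuous_mFourierCoeff_synth (hg n) (θ n) k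
  have hCc : ∀ n, Continuous (C n) := fun n => hcc.comp ((hΨc n).comp continuous_fst)
  have hCB : ∀ n z, |C n z| ≤ B := fun n z => hB _
  have hXm : ∀ n, AEStronglyMeasurable (X n) μ := fun n =>
    (continuous_const.mul (continuous_nsGeneratorPairing ν f (isSmooth_fourierTruncate (N n) a))).aestronglyMeasurable
  have hXM : ∀ n, ∀ᵐ u ∂μ, |X n u| ≤ M := fun n => hR.mono fun u hu => by
    show |θ n * nsGeneratorPairing ν f u (fourierTruncate (N n) a)| ≤ K * (1 + R ^ 2)
    rw [abs_mul, abs_of_nonneg (hθ01 n).1]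
    calc θ n * |nsGeneratorPairing ν f u (fourierTruncate (N n) a)| ≤ 1 * (K * (1 + ‖u‖ ^ 2)) :=
          mul_le_mul (hθ01 n).2 (hK _ u) (abs_nonneg _) zero_le_one
      _ ≤ K * (1 + R ^ 2) := by
          rw [one_mul]
          exact mul_le_mul_of_nonneg_left (by nlinarith [norm_nonneg u]) hK0
  have hpZ' : ∀ n z, p₁ n z = ∫ u, ρ n (z - Z n u) ∂μ := fun n z => hpZ n z
  -- the Jensen–Fubini package at every level
  have hJ := fun n => integral_abs_kernel_sub_le μ (vol n) (hZc n).measurable (hρc n) (hρ0 n) (hKρ n) (hρi n)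
    (hXm n) (hXM n) (hCc n) (hCB n)
  -- `s = (1 − ε)/q`: `0 ≤ s`, `s p₁ ≤ 1`
  have hs0 : ∀ n z, 0 ≤ s n z := fun n z => div_nonneg (by linarith [(hε n).2]) (hq n z).le
  have hsp : ∀ n z, s n z * p₁ n z ≤ 1 := fun n z => by
    show (1 - ε n) / ((1 - ε n) * p₁ n z + ε n * c n) * p₁ n z ≤ 1
    rw [div_mul_eq_mul_div, div_le_one (hq n z)]
    nlinarith [(hε n).1, hc0 n]
  -- the drift as a kernel average of the weights
  have hdriftE : ∀ n z, drift n z = s n z * ∫ u, ρ n (z - Z n u) * X n u ∂μ := fun n z => by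
    have hκ : ∀ j, Integrable (fun u => ρ n (z - Z n u) * nsGeneratorPairing ν f u (g n j)) μ := fun j => by
      obtain ⟨Kj, hKj0, hKj⟩ := exists_abs_nsGeneratorPairing_le ν f (hg n j)
      refine Integrable.of_bound ((((hρc n).comp (continuous_const.sub (hZc n))).mul
        (continuous_nsGeneratorPairing ν f (hg n j))).aestronglyMeasurable) (Kρ n * (Kj * (1 + R ^ 2)))
        (hR.mono fun u hu => ?_)
      rw [Real.norm_eq_abs, abs_mul, abs_of_nonneg (hρ0 n _)]
      exact mul_le_mul (hKρ n _) ((hKj u).trans (mul_le_mul_of_nonneg_left (by nlinarith [norm_nonneg u]) hKj0))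
        (abs_nonneg _) (hKρ0 n)
    have h := drift_integrand_eq hf (hg n) ha (hgA n a ha hadiv hamean) (θ n) (s n z) (fun u => ρ n (z - Z n u)) hκ
      (V n z) (J n z) (hV n z) (fun j => hJw n z j)
    show (∫ x, ⟪a x, θ n • ∑ j, (V n z).1 j • g n j x⟫_ℝ) = s n z * ∫ u, ρ n (z - Z n u) * (θ n * _) ∂μ
    rw [h, mul_comm (θ n) (s n z), mul_assoc, ← integral_const_mul]
    exact congrArg _ (integral_congr_ae (Eventually.of_forall fun u => by ring))
  -- continuity and boundedness of the level integrand
  have hsc : ∀ n, Continuous (s n) := fun n =>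
    continuous_const.div ((continuous_const.mul (hp n)).add continuous_const) fun z => (hq n z).ne'
  have hVc : ∀ n, Continuous (V n) := fun n => by
    rw [show V n = fun z => s n z • J n z from funext (hV n)]
    exact (hsc n).smul (hJc n)
  have hdriftc : ∀ n, Continuous (drift n) := fun n => by
    have h : drift n = fun z => θ n * ∑ j, (V n z).1 j * ∫ x, ⟪a x, g n j x⟫_ℝ :=
      funext fun z => integral_inner_synth (hg n) ha.integrable (θ n) (V n z).1
    rw [h]
    exact continuous_const.mul (continuous_finsetSum _ fun j _ =>
      ((PiLp.continuous_apply 2 _ j).comp (continuous_fst.comp (hVc n))).mul continuous_const)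
  have hGc : ∀ n, Continuous (G n) := fun n => ((hdriftc n).sub (hCc n)).abs
  have hdriftB : ∀ n z, |drift n z| ≤ M := fun n z => by
    rw [hdriftE n z, abs_mul, abs_of_nonneg (hs0 n z)]
    calc s n z * |∫ u, ρ n (z - Z n u) * X n u ∂μ| ≤ s n z * (M * p₁ n z) := by
          rw [hpZ' n z]
          exact mul_le_mul_of_nonneg_left ((hJ n).2.2.2.2 z) (hs0 n z)
      _ = M * (s n z * p₁ n z) := by ring
      _ ≤ M * 1 := mul_le_mul_of_nonneg_left (hsp n z) (by positivity)
      _ = M := mul_one M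
  have hGB : ∀ n z, |G n z| ≤ M + B := fun n z => by
    show |(|drift n z - C n z|)| ≤ M + B
    rw [abs_abs]
    exact (abs_sub _ _).trans (add_le_add (hdriftB n z) (hCB n z))
  -- the uniform part of the level law
  have hT4 := fun n => (stub_augCurrentLevelTransportTools μ (vol n) (hZc n).measurable (hρc n) (hρ0 n) (hρi n)
    (hGc n) (hGB n)).2.2.2 (m n) (ε n) (c n) (p₁ n) (Bx n) (hm n) (hε n).1 (hBxfin n) (hp1 n) (htr n)
  -- the small term `η = (ε c p₁ / q) |C|`: supported in the box, `≤ ε c B/(1 − ε)` there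
  have hη0 : ∀ n z, 0 ≤ η n z := fun n z =>
    mul_nonneg (div_nonneg (mul_nonneg (mul_nonneg (hε n).1.le (hc0 n).le) (hp0 n z)) (hq n z).le) (abs_nonneg _)
  have hηB : ∀ n z, η n z ≤ ε n * c n / (1 - ε n) * B := fun n z => by
    have h1 : p₁ n z / ((1 - ε n) * p₁ n z + ε n * c n) ≤ 1 / (1 - ε n) := by
      rw [div_le_div_iff₀ (hq n z) (by linarith [(hε n).2])]
      nlinarith [(hε n).1, hc0 n, hp0 n z]
    calc η n z = ε n * c n * (p₁ n z / ((1 - ε n) * p₁ n z + ε n * c n)) * |C n z| := by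
          show ε n * c n * p₁ n z / ((1 - ε n) * p₁ n z + ε n * c n) * |C n z| = _
          rw [mul_div_assoc]
      _ ≤ ε n * c n * (1 / (1 - ε n)) * B :=
          mul_le_mul (mul_le_mul_of_nonneg_left h1 (mul_nonneg (hε n).1.le (hc0 n).le)) (hCB n z)
            (abs_nonneg _) (by have := (hε n).1; have := (hε n).2; have := hc0 n; positivity)
      _ = ε n * c n / (1 - ε n) * B := by ring
  have hηoff : ∀ n, ∀ z ∉ Bx n, η n z = 0 := fun n z hz => by
    show ε n * c n * p₁ n z / ((1 - ε n) * p₁ n z + ε n * c n) * |C n z| = 0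
    rw [hpB n z hz, mul_zero, zero_div, zero_mul]
  have hηi : ∀ n, Integrable (η n) (vol n) := fun n =>
    (((continuous_const.mul (hp n)).div ((continuous_const.mul (hp n)).add continuous_const)
      fun z => (hq n z).ne').mul (hCc n).abs).integrable_of_hasCompactSupport
      (HasCompactSupport.intro ((isCompact_closedBall _ _).prod isCompact_Icc) (hηoff n))
  have hηint : ∀ n, ∫ z, η n z ∂(vol n) ≤ ε n / (1 - ε n) * B := fun n => by
    rw [← setIntegral_eq_integral_of_forall_compl_eq_zero (hηoff n)]
    have h : ‖∫ z in Bx n, η n z ∂(vol n)‖ ≤ ε n * c n / (1 - ε n) * B * (vol n (Bx n)).toReal :=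
      norm_setIntegral_le_of_norm_le_const (hBxfin n) fun z _ => by
        rw [Real.norm_eq_abs, abs_of_nonneg (hη0 n z)]
        exact hηB n z
    calc ∫ z in Bx n, η n z ∂(vol n) ≤ ‖∫ z in Bx n, η n z ∂(vol n)‖ := Real.le_norm_self _
      _ ≤ ε n * c n / (1 - ε n) * B * (vol n (Bx n)).toReal := h
      _ = ε n / (1 - ε n) * B * (c n * (vol n (Bx n)).toReal) := by ring
      _ = ε n / (1 - ε n) * B := by rw [(hT4 n).1, mul_one]
  -- pointwise: `|drift − C| p₁ ≤ |∫ ρ(z − Z u) X dμ − p₁ C| + η`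
  have hGp : ∀ n z, G n z * p₁ n z ≤
      |(∫ u, ρ n (z - Z n u) * X n u ∂μ) - (∫ u, ρ n (z - Z n u) ∂μ) * C n z| + η n z := fun n z => by
    rw [← hpZ' n z]
    have hkey : s n z * (∫ u, ρ n (z - Z n u) * X n u ∂μ) - C n z =
        s n z * ((∫ u, ρ n (z - Z n u) * X n u ∂μ) - p₁ n z * C n z) - (1 - s n z * p₁ n z) * C n z := by ring
    have h1sp : (1 - s n z * p₁ n z) * p₁ n z = ε n * c n * p₁ n z / ((1 - ε n) * p₁ n z + ε n * c n) := by
      show (1 - (1 - ε n) / ((1 - ε n) * p₁ n z + ε n * c n) * p₁ n z) * p₁ n z = _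
      field_simp [(hq n z).ne']
      ring
    show |drift n z - C n z| * p₁ n z ≤ |(∫ u, ρ n (z - Z n u) * X n u ∂μ) - p₁ n z * C n z| +
      ε n * c n * p₁ n z / ((1 - ε n) * p₁ n z + ε n * c n) * |C n z|
    rw [hdriftE n z, hkey, ← h1sp]
    have e1 : |s n z * ((∫ u, ρ n (z - Z n u) * X n u ∂μ) - p₁ n z * C n z)| =
        s n z * |(∫ u, ρ n (z - Z n u) * X n u ∂μ) - p₁ n z * C n z| := by
      rw [abs_mul, abs_of_nonneg (hs0 n z)]
    have e2 : |(1 - s n z * p₁ n z) * C n z| = (1 - s n z * p₁ n z) * |C n z| := by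
      rw [abs_mul, abs_of_nonneg (sub_nonneg.2 (hsp n z))]
    calc |s n z * ((∫ u, ρ n (z - Z n u) * X n u ∂μ) - p₁ n z * C n z) - (1 - s n z * p₁ n z) * C n z| * p₁ n z
        ≤ (s n z * |(∫ u, ρ n (z - Z n u) * X n u ∂μ) - p₁ n z * C n z| + (1 - s n z * p₁ n z) * |C n z|) * p₁ n z := by
          refine mul_le_mul_of_nonneg_right ((abs_sub _ _).trans (le_of_eq ?_)) (hp0 n z)
          rw [e1, e2]
      _ = s n z * p₁ n z * |(∫ u, ρ n (z - Z n u) * X n u ∂μ) - p₁ n z * C n z| +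
            (1 - s n z * p₁ n z) * p₁ n z * |C n z| := by ring
      _ ≤ 1 * |(∫ u, ρ n (z - Z n u) * X n u ∂μ) - p₁ n z * C n z| + (1 - s n z * p₁ n z) * p₁ n z * |C n z| :=
          add_le_add (mul_le_mul_of_nonneg_right (hsp n z) (abs_nonneg _)) le_rfl
      _ = _ := by rw [one_mul]
  -- the level bound
  have hbound : ∀ n, ∫ z, G n z ∂(m n) ≤ (1 - ε n) * ∫ u, Φ n u ∂μ + ε n * B + ε n * (M + B) := fun n => by
    have h1 : ∫ z, G n z * p₁ n z ∂(vol n) ≤ (∫ u, Φ n u ∂μ) + ε n / (1 - ε n) * B :=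
      calc ∫ z, G n z * p₁ n z ∂(vol n)
          ≤ ∫ z, (|(∫ u, ρ n (z - Z n u) * X n u ∂μ) - (∫ u, ρ n (z - Z n u) ∂μ) * C n z| + η n z) ∂(vol n) :=
            integral_mono_of_nonneg (Eventually.of_forall fun z => mul_nonneg (abs_nonneg _) (hp0 n z))
              ((hJ n).2.2.1.abs.add (hηi n)) (Eventually.of_forall (hGp n))
        _ = (∫ z, |(∫ u, ρ n (z - Z n u) * X n u ∂μ) - (∫ u, ρ n (z - Z n u) ∂μ) * C n z| ∂(vol n)) +
              ∫ z, η n z ∂(vol n) := integral_add (hJ n).2.2.1.abs (hηi n)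
        _ ≤ (∫ u, Φ n u ∂μ) + ε n / (1 - ε n) * B := add_le_add (hJ n).2.2.2.1 (hηint n)
    have h2 : ε n * c n * ∫ z in Bx n, G n z ∂(vol n) ≤ ε n * (M + B) := (le_abs_self _).trans (hT4 n).2
    have hε1 : (1 - ε n) ≠ 0 := by linarith [(hε n).2]
    calc ∫ z, G n z ∂(m n) = (1 - ε n) * ∫ z, G n z * p₁ n z ∂(vol n) + ε n * c n * ∫ z in Bx n, G n z ∂(vol n) :=
          htr n _ (hGc n)
      _ ≤ (1 - ε n) * ((∫ u, Φ n u ∂μ) + ε n / (1 - ε n) * B) + ε n * (M + B) :=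
          add_le_add (mul_le_mul_of_nonneg_left h1 (by linarith [(hε n).2])) h2
      _ = (1 - ε n) * ∫ u, Φ n u ∂μ + ε n * B + ε n * (M + B) := by
          rw [mul_add, show (1 - ε n) * (ε n / (1 - ε n) * B) = ε n * B by field_simp]
  -- dominated convergence in `u`
  have hptw : ∀ᵐ u ∂μ, Tendsto (fun n => Φ n u) atTop (𝓝 |nsGeneratorPairing ν f u a - cc (fun k : Fin 3 → ℤ =>
      mFourierCoeff (EuclideanSpace.complexify ∘ (u.1 : UnitAddTorus (Fin 3) → EuclideanSpace ℝ (Fin 3))) k)|) := by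
    filter_upwards [hR, hXlim] with u hu hXu
    exact stub_augCurrentLevelDriftBaseTools hR0 D g N δ θ hN (fun n => (hδ n).1) hδ0 hθ hg horth u hu (fun n => hgH n u) ρ hρ0 hρi
      hρ1 hρδ hcc hB (fun n => X n u) _ hXu
  have hlim : Tendsto (fun n => ∫ u, Φ n u ∂μ) atTop (𝓝 I) :=
    tendsto_integral_of_dominated_convergence (fun _ => M + B) (fun n => (hJ n).1.aestronglyMeasurable)
      (integrable_const _) (fun n => (hJ n).2.1.mono fun u hu => by
        rw [Real.norm_eq_abs]; rwa [hρ1 n, mul_one] at hu) hptw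
  have hfin : Tendsto (fun n => (1 - ε n) * ∫ u, Φ n u ∂μ + ε n * B + ε n * (M + B)) atTop
      (𝓝 ((1 - 0) * I + 0 * B + 0 * (M + B))) :=
    (((tendsto_const_nhds.sub hε0).mul hlim).add (hε0.mul_const B)).add (hε0.mul_const _)
  rw [sub_zero, one_mul, zero_mul, zero_mul, add_zero, add_zero] at hfin
  filter_upwards [hfin (Iio_mem_nhds (show I < I + γ by linarith))] with n hn
  exact (hbound n).trans (le_of_lt hn)

end Summit.AnomalousDissipation.AnomalousDissipation.Theorems.EnsembleRealization
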